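import Summits.BirchSwinnertonDyer.Rank1Residual.X10.SecondDescentOneLineRankOne
import HarnessLib

/-!
# R1SHA9 records, batch B part 01: RANK-ONE Ш-cells at `p = 3` (`#Ш_an = 9`, surjective `ρ̄_{E,3}`; book cells (3, X4) / (3, X11b) / (3, X7)) — `BSD(E,3)` from bsd.S18 (displayed), GZK, the two-engine descent count `#Sel³(E/ℚ) = 27` and ONE EMPTY second `3`-descent (cell `b2b-bsdres`, unit `b2b-bsdres-x10`, gen 57)

HONEST FRAMING (run/shared/lean/b2b/bsd-rank1-residual/, verbatim in every file): the goal of the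
cell is to DELETE the COMBINATION-SHAPED residual classes of the Birch–Swinnerton-Dyer formula for
ALL analytic-rank `≤ 1` elliptic curves over `ℚ` — "full BSD formula for every rank `≤ 1` curve in
class `C`" assembled STRICTLY from published theorems — so that the rank-`≤ 1` remainder becomes
exactly the CONSTRUCTION-SHAPED classes, which are TYPED (missing-input `Prop`s), NOT attempted.
This is not "finishing BSD". Theorems only (no definition, no named fact); NOTHING IS BOOKED here;
no class label changes (X4 / X7 / X11b keep their marks; their class-level typed inputs are untouched). Per pair.

**What this file is.** The RANK-ONE one-line door `X10/SecondDescentOneLineRankOne.lean` (p757852, x10 GEN 57;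
door `X10.bsdp_three_rankOne_of_card_selmerThree_of_oneNonDivisible` = the torsion-agnostic one-line door p696472 with
`r_an = 0` relaxed to `r_an ≤ 1` and `#Ш[3] ≤ 9` derived from the descent count by the tree's PROVED exact sequence count
`WeierstrassCurve.natCard_selmerGroup_eq`, AEC X.4.2(a)): at a curve `E/ℚ` of analytic rank `1` (GZK `hGZK`: rank `1`, `Ш`
finite) with `#Sel^(3)(E/ℚ) = 27 = 3^(1+2)` (so `#Ш[3] ≤ 9`, any torsion), ONE non-zero class of `Ш[3]` NOT divisible by `3`, and
`ord₃ #Ш_an = 2`, the Cassels–Tate pairing fact **bsd.S18** (Cassels 1962 = Silverman AEC X.4.14; tree named fact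
`WeierstrassCurve.exists_casselsTate_pairing`, DISPLAYED as the binder `hCT` exactly as on every C9 / C9-RED / D3 record) gives
`#Ш[3] = 9` (squareness from `1 < #Ш[3] ≤ 9` under the alternating non-degenerate pairing) and `Ш[9] = Ш[3]` (the orthogonal of
`Ш[3]` is `3Ш`, so the non-divisible class has a Gram partner; `X10.sq_nsmul_stable_of_gram`), hence `#Ш(E/ℚ)(3) = 9 = 3^(ord₃ #Ш_an)`,
i.e. Miller's `BSD(E,3)`. The two displayed arithmetic inputs are produced by TWO ENGINES WRITTEN APART, per input:
* `hcard : #Sel³(E/ℚ) = 27` — EXACT `3`-descent (Schaefer–Stoll): engine 1 = x11b `desc3lib.gp` (octic flex-point algebra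
  `A = ℚ(T)`, `A(S,3)` from a CERTIFIED class group — `bnfcertify(A,1) = 1` — and 3-saturated `S`-units, `H¹(ℚ,E[3];S)` cut by the
  norm / `w₁` conditions, local images REACHED at every `v ∈ S`; front `front_octic.gp`, x10 GEN 48 node-sampler patch of
  `localimage` only) ‖ engine 2 = x10b `desc3full_e2.py` (cypari2; independent code: octic + quartic resolvent algebras, own local
  image sampler, own saturation by residue characters, Mordell–Weil generator located in `Sel³`): `dim_𝔽₃ Sel^(3)(E/ℚ) = 3` on both.
* `h1 : ∃ x ∈ Ш[3], x ≠ 0, x ∉ 3Ш` — the plane cubic `C_η` of a basis element `η` of engine 1's `Sel³` (route-A stage A3,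
  `octic_a3a.gp` / `octic_a3bc.gp`: the obstruction algebra `A_ρ` split explicitly, `C_η ⊂ ℙ²` from the trace-zero coordinates,
  `Jac(C_η) ≅ E` over `ℚ` checked on `c₄, c₆`, `𝔽_p`-points at every good `5 ≤ p < 60`), MINIMISED and reduced to
  `C_min = λ·C_η(M·X)` (`M ∈ GL₃(ℚ)`, `λ ∈ ℚ×` displayed; identity re-verified exactly by the minimiser), whose algebraic `3`-Selmer
  SET is EMPTY on both second-descent engines (B. Creutz, Math. Comp. 83 (2014) §7, F-part: engine 1 `ninedesc.gp` r6.2 —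
  flex algebra handled factor-wise, `bnfcertify(F,1) = 1`, local images certified as supersets, `Jac = E` re-decided — ‖ engine 2
  `ninedesc_e2_et.py` r4.1, SageMath): `Sel^(3)(C_min/ℚ) = ∅`. By Creutz's Lemma 3.8 (the image of `Sel^(3)(C_η/ℚ)` in
  `Ш(E/ℚ)[9]` is `{D : 3D = [C_η]}`) this says NO `D ∈ Ш` has `3D = [C_η]`: so `[C_η] ≠ 0` and `[C_η] ∉ 3Ш` — in ANY rank, with NO
  Mordell–Weil datum (equivalently: `η ∉ 3·Sel^(9)(E/ℚ) ⊇ κ₃(E(ℚ)) = 3·κ₉(E(ℚ))`); a cubic on the Mordell–Weil line has a rational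
  point, is CONSISTENT under the second descent, and is never cited.
* `hr : r_an = 1`, `hq`/`hv : ord₃ #Ш_an = 2` — DISPLAYED (Cremona `allbsd`: rank-one analytic order `L′(E,1)/(Ω·Reg·∏c/#tors²)`
  to the table's precision = `9.000…`; the desk's rank-one analytic-order clause prices it, as on every rank-one record of the book).
NO torsion binder (`#E(ℚ)_tors ∈ {1, 2}` here anyway), NO pairing VALUE, NO Kato / Skinner–Urban / main conjecture, NO image or
reduction hypothesis at `3`. Ellipticity of the literal Cremona model is an instance binder (kernel-decidable, left displayed).
Documents: SEALED at filing (write-once) under `HOME/b2b-bsdres-x10/g57/docs-R1/` (`front/ d3f/ a3x/ cubx/ e1/ e2/`, `SHA256SUMS` —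
the 16 hex digits cited below are its prefixes —, `SOURCES.tsv` = producing kit job per file); kits `HOME/b2b-bsdres-x10/g57/kit/`
(`front57` `d3f57` `a3x57` `cubx57` `c9e157` `c9e257`, byte provenance in `KITS.md`); driver `gen57/r1sha9.py`; cell file X10-AUDIT.md §63.

References: J. W. S. Cassels 1962 (IV) [Cassels1962ArithmeticIV]; Cassels 1998 §1 [Cassels1998]; Silverman AEC Thm. X.4.2(a),
X.4.14 [SilvermanAEC2009]; B. Creutz, Math. Comp. 83 (2014) Thm. 7.2, Alg. 7.3 [Creutz2014]; R. L. Miller 2011 Def. 1.1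
[Miller2011LMS]; J. E. Cremona, tables [Cremona2006]; E. F. Schaefer – M. Stoll 2004 [SchaeferStoll2004];
T. Fisher – R. Newton 2014 (flex algebra / plane cubics of 3-coverings) [FisherNewton2014].
-/

set_option autoImplicit false

noncomputable section

open scoped Classical

open WeierstrassCurve Literature.NumberTheory.EllipticCurves
  Literature.NumberTheory.EllipticCurves.Rank1Residual
  Literature.NumberTheory.EllipticCurves.Rank1Residual.Typed

namespace Summit.BirchSwinnertonDyer.Rank1Residual.X10
/-! ### `133956n1` -/

/-- **`BSD(E,3)` for `133956n1`** (`N = 133956 = 2²·3²·61²`, additive at `3`, `ρ̄_{E,3}` SURJECTIVE (Cremona `galrep`: no entry at `3`); Cremona's minimal model `[0, 0, 0, 33489, -36770922]`;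
analytic rank `1` (Cremona generator `[1647:66978:1]`), `#E(ℚ)_tors = 1`, `∏ c_ℓ = 24`, `#Ш_an = 9.00000000000000` so `ord₃ #Ш_an = 2`; book cell (3, X4) RESIDUE on
referee A2's R1113 output 7c4a3c30d8 of 2026-08-30) from the Cassels–Tate pairing fact bsd.S18 (`hCT`, displayed), GZK, and the two two-engine inputs of the R1SHA9 certificate:
`hcard`: ENGINE 1 x11b `desc3lib.gp` front (kit j337834): `S = [2, 3, 61]`, `Cl(A) = [4, [4]]`, `10` generators of `A(S,3)`, `dim H¹(ℚ,E[3];S) = 3`,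
**`dim Sel³(E/ℚ) = 3`**, mode `EXACT(bnfcertify1+3sat)` (PARI analytic-rank datum `[1, 10.8859077763731]`; MW `mw:rank(ellrank)>=1 pts=1 F(P) in <Sel> as [[1, 1, 1]]`) ‖ ENGINE 2 x10b `desc3full_e2.py` (kit j337849): `S = [2, 3, 61]`,
`Cl(A) = [4, [4]]`, `bnfcertify(A,1) = 1`, `dim H¹_S = 3`, **`dim Sel³ = 3`**, mode `EXACT(bnfcertify1+3sat)`, Mordell–Weil rank in `Sel³` = 1, verdict `dimSha[3]=2`
⟹ **`#Sel³(E/ℚ) = 27`**. `h1`: line `eta1` of engine 1's `Sel³` basis — stage-A3 cubic (kit j338243) minimised/reduced (`cubx57`, `M = [517,70,4977;-6501,-881,-62562;-3084,-418,-29677]`, `λ = 1/125`) to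
`C_min : -3x³ − 5x²y + 10x²w − xy² + 6xyw + 4xw² + 13y³ − 10y²w + 2yw² + 52w³ = 0`; second `3`-descent EMPTY on BOTH engines: E1 `ninedesc.gp r6.2` (kit j338282, seed 1, `S = [2, 3, 61]`, flex field `F` = `t^9 - 3*t^8 + 15*t^7 + 117*t^6 - 639*t^5 + 3231*t^4 - 2547*t^3 - 11313*t^2 + 74898*t - 111600` (disc -1314241884997641648), `Cl(F) = [[]]`, `bnfcertify(F,1) = 1`, 13 generators of `F(S,3)`, completeness «R = 13 = unit ranks (+zeta) 5 + #S_F 8 + k_comp 0; residue-character rank = R; bnfcertify(1) = 1», affine system rank 7 < 8 with the right-hand side ⇒ NO solution ⇒ `Sel³(C_min/ℚ) = ∅` [EMPTY = 1; `Jac = E`: 1; 7.385 s; doc `c9_133956n1_eta1.json` 53d91f987e4ce1f1]) ‖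
E2 `ninedesc_e2_et.py r4.3` (SageMath version 10.9; kit j338283, seed 2, `S = [2, 3, 61]`, `F` disc -1314241884997641648, `Cl(F) = [[]]`, proof_number_field = False, 13 generators, system rank 7 < 8 ⇒ EMPTY = True; 2.0 s; doc `c9e2_133956n1_eta1.json` fd6d95d95e118c55) ⟹ (Creutz Lemma 3.8) no `D ∈ Ш(E/ℚ)` with `3D = [C_η]`: **`[C_η] ≠ 0` in `Ш(E/ℚ)[3]` and `[C_η] ∉ 3·Ш(E/ℚ)`**.
Per pair; not a class theorem; books nothing. [cite: Creutz2014, Lemma 3.8, Thm. 7.2 and Alg. 7.3] [cite: Cassels1962ArithmeticIV] [cite: Miller2011LMS, Def. 1.1]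
[cite: SilvermanAEC2009, Thm X.4.2(a) and Thm. X.4.14] -/
theorem bsdp_r1sha9_e133956n1 (hCT : exists_casselsTate_pairing (K := ℚ))
    (hGZK : rank_eq_analyticRank_of_analyticRank_le_one)
    (W : WeierstrassCurve ℚ) [W.IsElliptic] (hW : W = ⟨0, 0, 0, 33489, (-36770922)⟩)
    (hr : W.analyticRank = 1)
    (hcard : Nat.card (W.selmerGroup (3 : ℤ)) = 27)
    (h1 : ∃ x : W.sha, 3 • x = 0 ∧ x ≠ 0 ∧ ∀ z : W.sha, 3 • z ≠ x)
    {q : ℚ} (hq : shaAn W = (q : ℂ)) (hv : padicValRat 3 q = 2) : BSDp W 3 := by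
  subst hW
  exact bsdp_three_rankOne_of_card_selmerThree_of_oneNonDivisible hCT hGZK _ hr hcard h1 hq hv

/-! ### `213390h1` -/

/-- **`BSD(E,3)` for `213390h1`** (`N = 213390 = 2·3²·5·2371`, additive at `3`, `ρ̄_{E,3}` SURJECTIVE (Cremona `galrep`: no entry at `3`); Cremona's minimal model `[1, -1, 0, -112387509, -516396028235]`;
analytic rank `1` (Cremona generator `[14781:1018067:1]`), `#E(ℚ)_tors = 2`, `∏ c_ℓ = 24`, `#Ш_an = 9.00000000000000` so `ord₃ #Ш_an = 2`; book cell (3, X4) RESIDUE on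
referee A2's R1113 output 7c4a3c30d8 of 2026-08-30) from the Cassels–Tate pairing fact bsd.S18 (`hCT`, displayed), GZK, and the two two-engine inputs of the R1SHA9 certificate:
`hcard`: ENGINE 1 x11b `desc3lib.gp` front (kit j337835): `S = [2, 3, 5, 2371]`, `Cl(A) = [2, [2]]`, `16` generators of `A(S,3)`, `dim H¹(ℚ,E[3];S) = 3`,
**`dim Sel³(E/ℚ) = 3`**, mode `EXACT(bnfcertify1+3sat)` (PARI analytic-rank datum `[1, 6.20274156664292]`; MW `mw:rank(ellrank)>=1 pts=1 F(P) in <Sel> as [[0, 1, 1]]`) ‖ ENGINE 2 x10b `desc3full_e2.py` (kit j337851): `S = [2, 3, 5, 2371]`,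
`Cl(A) = [2, [2]]`, `bnfcertify(A,1) = 1`, `dim H¹_S = 3`, **`dim Sel³ = 3`**, mode `EXACT(bnfcertify1+3sat)`, Mordell–Weil rank in `Sel³` = 1, verdict `dimSha[3]=2`
⟹ **`#Sel³(E/ℚ) = 27`**. `h1`: line `eta1` of engine 1's `Sel³` basis — stage-A3 cubic (kit j338245) minimised/reduced (`cubx57`, `M = [-5797,-19985,20812;1552,5348,-5569;10177,35081,-36532]`, `λ = 1/5668704`) to
`C_min : 62x³ + 62x²y + 73x²w + 38xy² − 97xyw + 53xw² + 48y³ + 15y²w − 102yw² + 75w³ = 0`; second `3`-descent EMPTY on BOTH engines: E1 `ninedesc.gp r6.2` (kit j338284, seed 1, `S = [2, 3, 5, 2371]`, flex field `F` = `t^9 - t^8 - 157*t^7 + 637*t^6 + 5567*t^5 - 37324*t^4 + 25834*t^3 + 160961*t^2 + 33458*t - 743295` (disc -89573594110516328112), `Cl(F) = [[]]`, `bnfcertify(F,1) = 1`, 19 generators of `F(S,3)`, completeness «R = 19 = unit ranks (+zeta) 5 + #S_F 14 + k_comp 0; residue-character rank = R; bnfcertify(1) = 1», affine system rank 12 < 13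 with the right-hand side ⇒ NO solution ⇒ `Sel³(C_min/ℚ) = ∅` [EMPTY = 1; `Jac = E`: 1; 53.714 s; doc `c9_213390h1_eta1.json` 0b761f0bafd334c3]) ‖
E2 `ninedesc_e2_et.py r4.3` (SageMath version 10.9; kit j338285, seed 2, `S = [2, 3, 5, 2371]`, `F` disc -89573594110516328112, `Cl(F) = [[]]`, proof_number_field = False, 19 generators, system rank 12 < 13 ⇒ EMPTY = True; 3.1 s; doc `c9e2_213390h1_eta1.json` 6dbfce7d3f5e37b6) ⟹ (Creutz Lemma 3.8) no `D ∈ Ш(E/ℚ)` with `3D = [C_η]`: **`[C_η] ≠ 0` in `Ш(E/ℚ)[3]` and `[C_η] ∉ 3·Ш(E/ℚ)`**.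
Per pair; not a class theorem; books nothing. [cite: Creutz2014, Lemma 3.8, Thm. 7.2 and Alg. 7.3] [cite: Cassels1962ArithmeticIV] [cite: Miller2011LMS, Def. 1.1]
[cite: SilvermanAEC2009, Thm X.4.2(a) and Thm. X.4.14] -/
theorem bsdp_r1sha9_e213390h1 (hCT : exists_casselsTate_pairing (K := ℚ))
    (hGZK : rank_eq_analyticRank_of_analyticRank_le_one)
    (W : WeierstrassCurve ℚ) [W.IsElliptic] (hW : W = ⟨1, (-1), 0, (-112387509), (-516396028235)⟩)
    (hr : W.analyticRank = 1)
    (hcard : Nat.card (W.selmerGroup (3 : ℤ)) = 27)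
    (h1 : ∃ x : W.sha, 3 • x = 0 ∧ x ≠ 0 ∧ ∀ z : W.sha, 3 • z ≠ x)
    {q : ℚ} (hq : shaAn W = (q : ℂ)) (hv : padicValRat 3 q = 2) : BSDp W 3 := by
  subst hW
  exact bsdp_three_rankOne_of_card_selmerThree_of_oneNonDivisible hCT hGZK _ hr hcard h1 hq hv

/-! ### `310329i1` -/

/-- **`BSD(E,3)` for `310329i1`** (`N = 310329 = 3²·29²·41`, additive at `3`, `ρ̄_{E,3}` SURJECTIVE (Cremona `galrep`: no entry at `3`); Cremona's minimal model `[0, 0, 1, 512169, -1756001903]`;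
analytic rank `1` (Cremona generator `[82418:8378879:8]`), `#E(ℚ)_tors = 1`, `∏ c_ℓ = 24`, `#Ш_an = 9.00000000000000` so `ord₃ #Ш_an = 2`; book cell (3, X4) RESIDUE on
referee A2's R1113 output 7c4a3c30d8 of 2026-08-30) from the Cassels–Tate pairing fact bsd.S18 (`hCT`, displayed), GZK, and the two two-engine inputs of the R1SHA9 certificate:
`hcard`: ENGINE 1 x11b `desc3lib.gp` front (kit j337836): `S = [3, 29, 41]`, `Cl(A) = [1, []]`, `12` generators of `A(S,3)`, `dim H¹(ℚ,E[3];S) = 4`,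
**`dim Sel³(E/ℚ) = 3`**, mode `EXACT(bnfcertify1+3sat)` (PARI analytic-rank datum `[1, 20.7888960776989]`; MW `mw:rank(ellrank)>=1 pts=1 F(P) in <Sel> as [[0, 0, 2]]`) ‖ ENGINE 2 x10b `desc3full_e2.py` (kit j337853): `S = [3, 29, 41]`,
`Cl(A) = [1, []]`, `bnfcertify(A,1) = 1`, `dim H¹_S = 4`, **`dim Sel³ = 3`**, mode `EXACT(bnfcertify1+3sat)`, Mordell–Weil rank in `Sel³` = 1, verdict `dimSha[3]=2`
⟹ **`#Sel³(E/ℚ) = 27`**. `h1`: line `eta1` of engine 1's `Sel³` basis — stage-A3 cubic (kit j338247) minimised/reduced (`cubx57`, `M = [61,-7,-235;27,-3,-105;27,-3,-103]`, `λ = 1/72`) to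
`C_min : -23x³ − 8x²y − 60x²w + 10xy² − 24xyw − 3xw² − 9y³ + 15y²w − 18yw² − 45w³ = 0`; second `3`-descent EMPTY on BOTH engines: E1 `ninedesc.gp r6.2` (kit j338286, seed 1, `S = [2, 3, 29, 41]`, flex field `F` = `t^9 - 3*t^8 + 9*t^7 - 189*t^6 + 540*t^5 - 522*t^4 - 390*t^3 + 414*t^2 - 135*t + 9` (disc -28677826917295385787), `Cl(F) = [[]]`, `bnfcertify(F,1) = 1`, 15 generators of `F(S,3)`, completeness «R = 15 = unit ranks (+zeta) 5 + #S_F 10 + k_comp 0; residue-character rank = R; bnfcertify(1) = 1», affine system rank 8 < 9 with the right-hand side ⇒ NO solution ⇒ `Sel³(C_min/ℚ) = ∅` [EMPTY = 1; `Jac = E`: 1; 28.806 s; doc `c9_310329i1_eta1.json` 3b4b2fa04f8992fa]) ‖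
E2 `ninedesc_e2_et.py r4.3` (SageMath version 10.9; kit j338288, seed 2, `S = [2, 3, 29, 41]`, `F` disc -28677826917295385787, `Cl(F) = [[]]`, proof_number_field = False, 15 generators, system rank 8 < 9 ⇒ EMPTY = True; 1.5 s; doc `c9e2_310329i1_eta1.json` 6fcd4573a239aa16) ⟹ (Creutz Lemma 3.8) no `D ∈ Ш(E/ℚ)` with `3D = [C_η]`: **`[C_η] ≠ 0` in `Ш(E/ℚ)[3]` and `[C_η] ∉ 3·Ш(E/ℚ)`**.
Per pair; not a class theorem; books nothing. [cite: Creutz2014, Lemma 3.8, Thm. 7.2 and Alg. 7.3] [cite: Cassels1962ArithmeticIV] [cite: Miller2011LMS, Def. 1.1]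
[cite: SilvermanAEC2009, Thm X.4.2(a) and Thm. X.4.14] -/
theorem bsdp_r1sha9_e310329i1 (hCT : exists_casselsTate_pairing (K := ℚ))
    (hGZK : rank_eq_analyticRank_of_analyticRank_le_one)
    (W : WeierstrassCurve ℚ) [W.IsElliptic] (hW : W = ⟨0, 0, 1, 512169, (-1756001903)⟩)
    (hr : W.analyticRank = 1)
    (hcard : Nat.card (W.selmerGroup (3 : ℤ)) = 27)
    (h1 : ∃ x : W.sha, 3 • x = 0 ∧ x ≠ 0 ∧ ∀ z : W.sha, 3 • z ≠ x)
    {q : ℚ} (hq : shaAn W = (q : ℂ)) (hv : padicValRat 3 q = 2) : BSDp W 3 := by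
  subst hW
  exact bsdp_three_rankOne_of_card_selmerThree_of_oneNonDivisible hCT hGZK _ hr hcard h1 hq hv

/-! ### `318828a1` -/

/-- **`BSD(E,3)` for `318828a1`** (`N = 318828 = 2²·3·163²`, multiplicative at `3`, `ρ̄_{E,3}` SURJECTIVE (Cremona `galrep`: no entry at `3`); Cremona's minimal model `[0, -1, 0, -1204461, 870560838]`;
analytic rank `1` (Cremona generator `[2717:132845:1]`), `#E(ℚ)_tors = 2`, `∏ c_ℓ = 12`, `#Ш_an = 9.00000000000000` so `ord₃ #Ш_an = 2`; book cell (3, X11b) RESIDUE on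
referee A2's R1113 output 7c4a3c30d8 of 2026-08-30) from the Cassels–Tate pairing fact bsd.S18 (`hCT`, displayed), GZK, and the two two-engine inputs of the R1SHA9 certificate:
`hcard`: ENGINE 1 x11b `desc3lib.gp` front (kit j337839): `S = [2, 3, 163]`, `Cl(A) = [1, []]`, `11` generators of `A(S,3)`, `dim H¹(ℚ,E[3];S) = 3`,
**`dim Sel³(E/ℚ) = 3`**, mode `EXACT(bnfcertify1+3sat)` (PARI analytic-rank datum `[1, 10.8328116169635]`; MW `mw:rank(ellrank)>=1 pts=1 F(P) in <Sel> as [[0, 1, 2]]`) ‖ ENGINE 2 x10b `desc3full_e2.py` (kit j337857): `S = [2, 3, 163]`,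
`Cl(A) = [1, []]`, `bnfcertify(A,1) = 1`, `dim H¹_S = 3`, **`dim Sel³ = 3`**, mode `EXACT(bnfcertify1+3sat)`, Mordell–Weil rank in `Sel³` = 1, verdict `dimSha[3]=2`
⟹ **`#Sel³(E/ℚ) = 27`**. `h1`: line `eta1` of engine 1's `Sel³` basis — stage-A3 cubic (kit j338250) minimised/reduced (`cubx57`, `M = [823,100,22;-1906,-220,-8;210,24,0]`, `λ = 1/576`) to
`C_min : 8x³ + 2x²y − 52x²w + xy² − 28xyw − 36xw² − 14y³ − 3y²w + 19yw² + 17w³ = 0`; second `3`-descent EMPTY on BOTH engines: E1 `ninedesc.gp r6.2` (kit j338289, seed 1, `S = [2, 3, 163]`, flex field `F` = `t^9 - 3*t^8 - 54*t^7 + 601*t^6 - 2142*t^5 + 2295*t^4 + 1229*t^3 - 5394*t^2 - 312*t - 1344` (disc -5906591030463218352), `Cl(F) = [[]]`, `bnfcertify(F,1) = 1`, 14 generators of `F(S,3)`, completeness «R = 14 = unit ranks (+zeta) 5 + #S_F 9 + k_comp 0; residue-character rank = R; bnfcertify(1) = 1», affine system rank 8 < 9 with the right-hand side ⇒ NO solution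 ⇒ `Sel³(C_min/ℚ) = ∅` [EMPTY = 1; `Jac = E`: 1; 16.963 s; doc `c9_318828a1_eta1.json` 491ed3021377a132]) ‖
E2 `ninedesc_e2_et.py r4.3` (SageMath version 10.9; kit j338290, seed 2, `S = [2, 3, 163]`, `F` disc -5906591030463218352, `Cl(F) = [[]]`, proof_number_field = False, 14 generators, system rank 8 < 9 ⇒ EMPTY = True; 2.3 s; doc `c9e2_318828a1_eta1.json` 954b25216f70f3e2) ⟹ (Creutz Lemma 3.8) no `D ∈ Ш(E/ℚ)` with `3D = [C_η]`: **`[C_η] ≠ 0` in `Ш(E/ℚ)[3]` and `[C_η] ∉ 3·Ш(E/ℚ)`**.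
Per pair; not a class theorem; books nothing. [cite: Creutz2014, Lemma 3.8, Thm. 7.2 and Alg. 7.3] [cite: Cassels1962ArithmeticIV] [cite: Miller2011LMS, Def. 1.1]
[cite: SilvermanAEC2009, Thm X.4.2(a) and Thm. X.4.14] -/
theorem bsdp_r1sha9_e318828a1 (hCT : exists_casselsTate_pairing (K := ℚ))
    (hGZK : rank_eq_analyticRank_of_analyticRank_le_one)
    (W : WeierstrassCurve ℚ) [W.IsElliptic] (hW : W = ⟨0, (-1), 0, (-1204461), 870560838⟩)
    (hr : W.analyticRank = 1)
    (hcard : Nat.card (W.selmerGroup (3 : ℤ)) = 27)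
    (h1 : ∃ x : W.sha, 3 • x = 0 ∧ x ≠ 0 ∧ ∀ z : W.sha, 3 • z ≠ x)
    {q : ℚ} (hq : shaAn W = (q : ℂ)) (hv : padicValRat 3 q = 2) : BSDp W 3 := by
  subst hW
  exact bsdp_three_rankOne_of_card_selmerThree_of_oneNonDivisible hCT hGZK _ hr hcard h1 hq hv

/-! ### `368358k1` -/

/-- **`BSD(E,3)` for `368358k1`** (`N = 368358 = 2·3·29²·73`, multiplicative at `3`, `ρ̄_{E,3}` SURJECTIVE (Cremona `galrep`: no entry at `3`); Cremona's minimal model `[1, 0, 1, -2541, 1424992]`;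
analytic rank `1` (Cremona generator `[70:1226:1]`), `#E(ℚ)_tors = 1`, `∏ c_ℓ = 3`, `#Ш_an = 9.00000000000000` so `ord₃ #Ш_an = 2`; book cell (3, X11b) RESIDUE on
referee A2's R1113 output 7c4a3c30d8 of 2026-08-30) from the Cassels–Tate pairing fact bsd.S18 (`hCT`, displayed), GZK, and the two two-engine inputs of the R1SHA9 certificate:
`hcard`: ENGINE 1 x11b `desc3lib.gp` front (kit j337840): `S = [2, 3, 29, 73]`, `Cl(A) = [3, [3]]`, `17` generators of `A(S,3)`, `dim H¹(ℚ,E[3];S) = 3`,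
**`dim Sel³(E/ℚ) = 3`**, mode `EXACT(bnfcertify1+3sat)` (PARI analytic-rank datum `[1, 8.22371541659565]`; MW `mw:rank(ellrank)>=1 pts=1 F(P) in <Sel> as [[1, 0, 2]]`) ‖ ENGINE 2 x10b `desc3full_e2.py` (kit j337860): `S = [2, 3, 29, 73]`,
`Cl(A) = [3, [3]]`, `bnfcertify(A,1) = 1`, `dim H¹_S = 3`, **`dim Sel³ = 3`**, mode `EXACT(bnfcertify1+3sat)`, Mordell–Weil rank in `Sel³` = 1, verdict `dimSha[3]=2`
⟹ **`#Sel³(E/ℚ) = 27`**. `h1`: line `eta1` of engine 1's `Sel³` basis — stage-A3 cubic (kit j338252) minimised/reduced (`cubx57`, `M = [5323,-26909,3489;-4850,24541,-3189;10810,-54551,7044]`, `λ = 1/13566416625`) to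
`C_min : -5x³ − 11x²y − 2x²w + 19xy² − xyw − 8xw² + 4y³ − 11y²w − 2yw² − w³ = 0`; second `3`-descent EMPTY on BOTH engines: E1 `ninedesc.gp r6.2` (kit j338291, seed 1, `S = [2, 3, 29, 73]`, flex field `F` = `t^9 - 9*t^7 - 251*t^6 - 75*t^5 + 6468*t^4 + 18143*t^3 - 161337*t^2 + 210480*t + 8225` (disc -32022832478819822883), `Cl(F) = [[]]`, `bnfcertify(F,1) = 1`, 17 generators of `F(S,3)`, completeness «R = 17 = unit ranks (+zeta) 5 + #S_F 12 + k_comp 0; residue-character rank = R; bnfcertify(1) = 1», affine system rank 10 < 11 with the right-hand side ⇒ NO solution ⇒ `Sel³(C_min/ℚ) = ∅` [EMPTY = 1; `Jac = E`: 1; 32.053 s; doc `c9_368358k1_eta1.json` cfe59755d7454a2c]) ‖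
E2 `ninedesc_e2_et.py r4.3` (SageMath version 10.9; kit j338292, seed 2, `S = [2, 3, 29, 73]`, `F` disc -32022832478819822883, `Cl(F) = [[]]`, proof_number_field = False, 17 generators, system rank 10 < 11 ⇒ EMPTY = True; 2.7 s; doc `c9e2_368358k1_eta1.json` 484a31f4b30c6dc3) ⟹ (Creutz Lemma 3.8) no `D ∈ Ш(E/ℚ)` with `3D = [C_η]`: **`[C_η] ≠ 0` in `Ш(E/ℚ)[3]` and `[C_η] ∉ 3·Ш(E/ℚ)`**.
Per pair; not a class theorem; books nothing. [cite: Creutz2014, Lemma 3.8, Thm. 7.2 and Alg. 7.3] [cite: Cassels1962ArithmeticIV] [cite: Miller2011LMS, Def. 1.1]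
[cite: SilvermanAEC2009, Thm X.4.2(a) and Thm. X.4.14] -/
theorem bsdp_r1sha9_e368358k1 (hCT : exists_casselsTate_pairing (K := ℚ))
    (hGZK : rank_eq_analyticRank_of_analyticRank_le_one)
    (W : WeierstrassCurve ℚ) [W.IsElliptic] (hW : W = ⟨1, 0, 1, (-2541), 1424992⟩)
    (hr : W.analyticRank = 1)
    (hcard : Nat.card (W.selmerGroup (3 : ℤ)) = 27)
    (h1 : ∃ x : W.sha, 3 • x = 0 ∧ x ≠ 0 ∧ ∀ z : W.sha, 3 • z ≠ x)
    {q : ℚ} (hq : shaAn W = (q : ℂ)) (hv : padicValRat 3 q = 2) : BSDp W 3 := by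
  subst hW
  exact bsdp_three_rankOne_of_card_selmerThree_of_oneNonDivisible hCT hGZK _ hr hcard h1 hq hv


end Summit.BirchSwinnertonDyer.Rank1Residual.X10

end
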